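import Summits.Ventures.PercRepro.S1CoreCapEightTwoChord

/-!
# PercRepro — TOWARDS `Q*(8)`: THREE PAIRWISE DISJOINT BIG LINES (p1, gen 28)

Case (A0) of the last open case at nullity `8`, by the SUB-CONFIGURATION trick. Removing the third big line `C`
leaves a configuration of the spec with two disjoint big lines `A, B`; if no point off `A ∪ B` carries two of its
chords (chord uniqueness), its cap is `≤ 18` (`sum_cap_le_eighteen_of_two_big_chord_unique`, S1CoreCapEightTwoChord)
and the whole is `≤ 18 + cap C ≤ 23` (`sum_cap_le_twenty_three_of_chordUnique`). Otherwise every pair has a HUB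
with two chords, and the plane on them is exactly `A ∪ B ∪ {v}` (`subset_plane_of_two_chords`): a chord of another
pair with two points on that plane has its third point equal to the hub, which forces each hub off the third line
and the three hubs pairwise distinct, so the three chords are three free lines after `[C, B, A]` — more than the
budget `14 − Σ|L_i| ≤ 2` (`sum_cap_le_twenty_five_of_three_disjoint`). `proofs/P1-S4-CAPBRIDGE.md` §20.
Axioms: standard.
-/

namespace PercRepro

namespace S1

namespace FourCap

namespace Eight

open Seven

variable {β : Type} [DecidableEq β]

section ThreeDisjoint

variable {w : β → ℕ} {ls : Finset (Finset β)}
  (h1 : ∀ L ∈ ls, ∀ v ∈ L, w v = 1 ∨ w v = 2)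
  (h2 : ∀ L ∈ ls, 3 ≤ L.card ∧ wsum w L ≤ 5)
  (h3 : ∀ L ∈ ls, ∀ L' ∈ ls, L ≠ L' → (L ∩ L').card ≤ 1)
  (h4 : ∀ l : List (Finset β), l.Nodup → (∀ L ∈ l, L ∈ ls) → wsum w (unionL l) ≤ 8 + lineRank l)
  (h5 : ∀ l : List (Finset β), l.Nodup → (∀ L ∈ l, L ∈ ls) → lineRank l ≤ 3 → (unionL l).card ≤ 9)
  {A B C : Finset β} (hA : A ∈ ls) (hB : B ∈ ls) (hC : C ∈ ls)
  (hBA : B ≠ A) (hCA : C ≠ A) (hCB : C ≠ B)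
  (cA : 4 ≤ A.card) (cB : 4 ≤ B.card) (cC : 4 ≤ C.card)
  (hrest : ∀ L ∈ ls, L ≠ A → L ≠ B → L ≠ C → L.card = 3)

include h1 h2 h3 h4 hA hB hC hBA hCA hCB cA cB cC hrest in
/-- **The sub-configuration trick**: if the pair `(A, B)` has at most one chord per hub in the configuration
without `C`, the cap sum is `≤ 18 + cap C ≤ 23`. -/
theorem sum_cap_le_twenty_three_of_chordUnique (hdisj : (B ∩ A).card = 0)
    (hu : ∀ v, v ∉ A ∪ B → ∀ c ∈ ls.erase C, ∀ c' ∈ ls.erase C, c ≠ A → c ≠ B → c' ≠ A → c' ≠ B →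
      v ∈ c → v ∈ c' → (c ∩ (A ∪ B)).card = 2 → (c' ∩ (A ∪ B)).card = 2 → c = c') :
    ∑ L ∈ ls, capPaper L.card (fat w L) ≤ 23 := by
  have hsub : ∀ L ∈ ls.erase C, L ∈ ls := fun L hL => (Finset.mem_erase.1 hL).2
  have h18 := sum_cap_le_eighteen_of_two_big_chord_unique (ls := ls.erase C) (w := w)
    (fun L hL => h1 L (hsub L hL)) (fun L hL => h2 L (hsub L hL))
    (fun L hL L' hL' hne => h3 L (hsub L hL) L' (hsub L' hL') hne)
    (fun l hnd hl => h4 l hnd (fun L hL => hsub L (hl L hL)))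
    (Finset.mem_erase.2 ⟨hCA.symm, hA⟩) (Finset.mem_erase.2 ⟨hCB.symm, hB⟩) hBA cA cB
    (fun L hL hLA hLB => hrest L (hsub L hL) hLA hLB (Finset.mem_erase.1 hL).1) hdisj hu
  have hsum := Finset.add_sum_erase ls (fun L => capPaper L.card (fat w L)) hC
  rw [← hsum, capPaper_big_eq h1 h2 hC cC]
  have := wsum_eq_card_add_fat w C (h1 C hC)
  have := (h2 C hC).2
  omega

include h1 h2 h3 h4 h5 hA hB hC hBA hCA hCB cA cB cC hrest in
/-- **(A0) at nullity `8`: three pairwise disjoint big lines: cap sum `≤ 25`** (in fact `≤ 23`): some pair has at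
most one chord per hub (then the sub-configuration trick), or three hubs with two chords each exist and the plane
device makes their chords three free lines over `[C, B, A]`, against the budget. -/
theorem sum_cap_le_twenty_five_of_three_disjoint (d12 : (B ∩ A).card = 0) (d13 : (C ∩ A).card = 0)
    (d23 : (C ∩ B).card = 0) : ∑ L ∈ ls, capPaper L.card (fat w L) ≤ 25 := by
  by_cases uAB : ∀ v, v ∉ A ∪ B → ∀ c ∈ ls.erase C, ∀ c' ∈ ls.erase C, c ≠ A → c ≠ B → c' ≠ A → c' ≠ B →
      v ∈ c → v ∈ c' → (c ∩ (A ∪ B)).card = 2 → (c' ∩ (A ∪ B)).card = 2 → c = c'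
  · exact (sum_cap_le_twenty_three_of_chordUnique h1 h2 h3 h4 hA hB hC hBA hCA hCB cA cB cC hrest d12 uAB).trans
      (by norm_num)
  by_cases uAC : ∀ v, v ∉ A ∪ C → ∀ c ∈ ls.erase B, ∀ c' ∈ ls.erase B, c ≠ A → c ≠ C → c' ≠ A → c' ≠ C →
      v ∈ c → v ∈ c' → (c ∩ (A ∪ C)).card = 2 → (c' ∩ (A ∪ C)).card = 2 → c = c'
  · exact (sum_cap_le_twenty_three_of_chordUnique h1 h2 h3 h4 hA hC hB hCA hBA hCB.symm cA cC cB
      (fun L hL hLA hLC hLB => hrest L hL hLA hLB hLC) d13 uAC).trans (by norm_num)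
  by_cases uBC : ∀ v, v ∉ B ∪ C → ∀ c ∈ ls.erase A, ∀ c' ∈ ls.erase A, c ≠ B → c ≠ C → c' ≠ B → c' ≠ C →
      v ∈ c → v ∈ c' → (c ∩ (B ∪ C)).card = 2 → (c' ∩ (B ∪ C)).card = 2 → c = c'
  · exact (sum_cap_le_twenty_three_of_chordUnique h1 h2 h3 h4 hB hC hA hCB hBA.symm hCA.symm cB cC cA
      (fun L hL hLB hLC hLA => hrest L hL hLA hLB hLC) d23 uBC).trans (by norm_num)
  exfalso
  push Not at uAB uAC uBC
  obtain ⟨v₁, hv₁, Y₁, hY₁, Y₁', hY₁', hY₁A, hY₁B, hY₁'A, hY₁'B, hvY₁, hvY₁', hY₁2, hY₁'2, hY₁ne⟩ := uAB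
  obtain ⟨v₂, hv₂, Y₂, hY₂, Y₂', hY₂', hY₂A, hY₂C, hY₂'A, hY₂'C, hvY₂, hvY₂', hY₂2, hY₂'2, hY₂ne⟩ := uAC
  obtain ⟨v₃, hv₃, Y₃, hY₃, Y₃', hY₃', hY₃B, hY₃C, hY₃'B, hY₃'C, hvY₃, hvY₃', hY₃2, hY₃'2, hY₃ne⟩ := uBC
  have hY₁C := (Finset.mem_erase.1 hY₁).1
  have hY₁'C := (Finset.mem_erase.1 hY₁').1
  have hY₂B := (Finset.mem_erase.1 hY₂).1
  have hY₂'B := (Finset.mem_erase.1 hY₂').1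
  have hY₃A := (Finset.mem_erase.1 hY₃).1
  have hY₃'A := (Finset.mem_erase.1 hY₃').1
  have hY₁s := (Finset.mem_erase.1 hY₁).2
  have hY₁'s := (Finset.mem_erase.1 hY₁').2
  have hY₂s := (Finset.mem_erase.1 hY₂).2
  have hY₂'s := (Finset.mem_erase.1 hY₂').2
  have hY₃s := (Finset.mem_erase.1 hY₃).2
  have hY₃'s := (Finset.mem_erase.1 hY₃').2
  have k₁ := hrest Y₁ hY₁s hY₁A hY₁B hY₁C
  have k₁' := hrest Y₁' hY₁'s hY₁'A hY₁'B hY₁'C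
  have k₂ := hrest Y₂ hY₂s hY₂A hY₂B hY₂C
  have k₂' := hrest Y₂' hY₂'s hY₂'A hY₂'B hY₂'C
  have k₃ := hrest Y₃ hY₃s hY₃A hY₃B hY₃C
  have k₃' := hrest Y₃' hY₃'s hY₃'A hY₃'B hY₃'C
  -- the three planes
  have hP₁ := subset_plane_of_two_chords h3 h5 hA hB hBA cA cB d12 hv₁ hY₁s hY₁'s hY₁ne hY₁A hY₁B hY₁'A hY₁'B k₁ k₁'
    hvY₁ hvY₁' hY₁2 hY₁'2
  have hP₂ := subset_plane_of_two_chords h3 h5 hA hC hCA cA cC d13 hv₂ hY₂s hY₂'s hY₂ne hY₂A hY₂C hY₂'A hY₂'C k₂ k₂'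
    hvY₂ hvY₂' hY₂2 hY₂'2
  -- the structure of the chords
  obtain ⟨hY₁A1, hY₁B1, hY₁sub⟩ := chord_structure k₁ (h3 Y₁ hY₁s A hA hY₁A) (h3 Y₁ hY₁s B hB hY₁B) hv₁ hvY₁ hY₁2
  obtain ⟨hY₁'A1, hY₁'B1, hY₁'sub⟩ :=
    chord_structure k₁' (h3 Y₁' hY₁'s A hA hY₁'A) (h3 Y₁' hY₁'s B hB hY₁'B) hv₁ hvY₁' hY₁'2
  obtain ⟨hY₂A1, hY₂C1, hY₂sub⟩ := chord_structure k₂ (h3 Y₂ hY₂s A hA hY₂A) (h3 Y₂ hY₂s C hC hY₂C) hv₂ hvY₂ hY₂2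
  obtain ⟨hY₂'A1, hY₂'C1, hY₂'sub⟩ :=
    chord_structure k₂' (h3 Y₂' hY₂'s A hA hY₂'A) (h3 Y₂' hY₂'s C hC hY₂'C) hv₂ hvY₂' hY₂'2
  obtain ⟨hY₃B1, hY₃C1, hY₃sub⟩ := chord_structure k₃ (h3 Y₃ hY₃s B hB hY₃B) (h3 Y₃ hY₃s C hC hY₃C) hv₃ hvY₃ hY₃2
  obtain ⟨hY₃'B1, hY₃'C1, hY₃'sub⟩ :=
    chord_structure k₃' (h3 Y₃' hY₃'s B hB hY₃'B) (h3 Y₃' hY₃'s C hC hY₃'C) hv₃ hvY₃' hY₃'2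
  have dAB : ∀ u, u ∈ A → u ∈ B → False := fun u huA huB => by
    have : u ∈ B ∩ A := Finset.mem_inter.2 ⟨huB, huA⟩
    rw [Finset.card_eq_zero.1 d12] at this
    exact Finset.notMem_empty u this
  have dAC : ∀ u, u ∈ A → u ∈ C → False := fun u huA huC => by
    have : u ∈ C ∩ A := Finset.mem_inter.2 ⟨huC, huA⟩
    rw [Finset.card_eq_zero.1 d13] at this
    exact Finset.notMem_empty u this
  have dBC : ∀ u, u ∈ B → u ∈ C → False := fun u huB huC => by
    have : u ∈ C ∩ B := Finset.mem_inter.2 ⟨huC, huB⟩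
    rw [Finset.card_eq_zero.1 d23] at this
    exact Finset.notMem_empty u this
  -- two points of a line in a set
  have two_le : ∀ (Y P : Finset β) (p q : β), p ∈ Y → p ∈ P → q ∈ Y → q ∈ P → p ≠ q → 2 ≤ (Y ∩ P).card := by
    intro Y P p q hpY hpP hqY hqP hpq
    have hsub : ({p, q} : Finset β) ⊆ Y ∩ P := by
      intro x hx
      simp only [Finset.mem_insert, Finset.mem_singleton] at hx
      rcases hx with rfl | rfl
      · exact Finset.mem_inter.2 ⟨hpY, hpP⟩
      · exact Finset.mem_inter.2 ⟨hqY, hqP⟩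
    have := Finset.card_le_card hsub
    rwa [Finset.card_pair hpq] at this
  -- two distinct lines of the configuration share at most one point: two common points collide
  have collide : ∀ Y Y' : Finset β, Y ∈ ls → Y' ∈ ls → Y ≠ Y' → ∀ p q, p ∈ Y → p ∈ Y' → q ∈ Y → q ∈ Y' →
      p ≠ q → False := by
    intro Y Y' hY hY' hne p q hpY hpY' hqY hqY' hpq
    have := two_le Y Y' p q hpY hpY' hqY hqY' hpq
    have := h3 Y hY Y' hY' hne
    omega
  -- a point of a line of the plane `L₁ ∪ L₂ ∪ {v}` on a line disjoint from `L₁, L₂` is the hub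
  have third : ∀ (L₁ L₂ : Finset β) (v : β), (∀ X ∈ ls, 2 ≤ (X ∩ (L₁ ∪ L₂ ∪ {v})).card → X ⊆ L₁ ∪ L₂ ∪ {v}) →
      ∀ Y ∈ ls, ∀ p q, p ∈ Y → p ∈ L₁ ∪ L₂ ∪ {v} → q ∈ Y → q ∈ L₁ ∪ L₂ ∪ {v} → p ≠ q →
      ∀ r, r ∈ Y → r ∉ L₁ → r ∉ L₂ → r = v := by
    intro L₁ L₂ v hPl Y hY p q hpY hpP hqY hqP hpq r hrY hr₁ hr₂
    have := hPl Y hY (two_le Y _ p q hpY hpP hqY hqP hpq) hrY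
    rcases Finset.mem_union.1 this with h | h
    · rcases Finset.mem_union.1 h with h | h
      · exact (hr₁ h).elim
      · exact (hr₂ h).elim
    · exact Finset.mem_singleton.1 h
  have exists_pt : ∀ (Y L : Finset β), (Y ∩ L).card = 1 → ∃ x, x ∈ Y ∧ x ∈ L := by
    intro Y L h
    obtain ⟨x, hx⟩ := Finset.card_eq_one.1 h
    have : x ∈ Y ∩ L := hx ▸ Finset.mem_singleton_self x
    exact ⟨x, (Finset.mem_inter.1 this).1, (Finset.mem_inter.1 this).2⟩
  obtain ⟨a₁, ha₁Y, ha₁A⟩ := exists_pt Y₁ A hY₁A1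
  obtain ⟨b₁, hb₁Y, hb₁B⟩ := exists_pt Y₁ B hY₁B1
  obtain ⟨a₁', ha₁'Y, ha₁'A⟩ := exists_pt Y₁' A hY₁'A1
  obtain ⟨b₁', hb₁'Y, hb₁'B⟩ := exists_pt Y₁' B hY₁'B1
  obtain ⟨a₂, ha₂Y, ha₂A⟩ := exists_pt Y₂ A hY₂A1
  obtain ⟨c₂, hc₂Y, hc₂C⟩ := exists_pt Y₂ C hY₂C1
  obtain ⟨a₂', ha₂'Y, ha₂'A⟩ := exists_pt Y₂' A hY₂'A1
  obtain ⟨c₂', hc₂'Y, hc₂'C⟩ := exists_pt Y₂' C hY₂'C1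
  obtain ⟨b₃, hb₃Y, hb₃B⟩ := exists_pt Y₃ B hY₃B1
  obtain ⟨c₃, hc₃Y, hc₃C⟩ := exists_pt Y₃ C hY₃C1
  obtain ⟨b₃', hb₃'Y, hb₃'B⟩ := exists_pt Y₃' B hY₃'B1
  obtain ⟨c₃', hc₃'Y, hc₃'C⟩ := exists_pt Y₃' C hY₃'C1
  have hv₁A : v₁ ∉ A := fun h => hv₁ (Finset.mem_union_left _ h)
  have hv₁B : v₁ ∉ B := fun h => hv₁ (Finset.mem_union_right _ h)
  have hv₂A : v₂ ∉ A := fun h => hv₂ (Finset.mem_union_left _ h)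
  have hv₂C : v₂ ∉ C := fun h => hv₂ (Finset.mem_union_right _ h)
  have hv₃B : v₃ ∉ B := fun h => hv₃ (Finset.mem_union_left _ h)
  have hv₃C : v₃ ∉ C := fun h => hv₃ (Finset.mem_union_right _ h)
  have memA : ∀ x, x ∈ A → x ∈ A ∪ B ∪ {v₁} := fun x hx => Finset.mem_union_left _ (Finset.mem_union_left _ hx)
  have memB : ∀ x, x ∈ B → x ∈ A ∪ B ∪ {v₁} := fun x hx => Finset.mem_union_left _ (Finset.mem_union_right _ hx)
  have memV₁ : v₁ ∈ A ∪ B ∪ {v₁} := Finset.mem_union_right _ (Finset.mem_singleton_self v₁)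
  have memA' : ∀ x, x ∈ A → x ∈ A ∪ C ∪ {v₂} := fun x hx => Finset.mem_union_left _ (Finset.mem_union_left _ hx)
  have memC' : ∀ x, x ∈ C → x ∈ A ∪ C ∪ {v₂} := fun x hx => Finset.mem_union_left _ (Finset.mem_union_right _ hx)
  have memV₂ : v₂ ∈ A ∪ C ∪ {v₂} := Finset.mem_union_right _ (Finset.mem_singleton_self v₂)
  -- (C1) `v₂ ∉ B`
  have hv₂B : v₂ ∉ B := by
    intro hv₂B
    have e := third A B v₁ hP₁ Y₂ hY₂s v₂ a₂ hvY₂ (memB v₂ hv₂B) ha₂Y (memA a₂ ha₂A)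
      (fun e => dAB v₂ (e ▸ ha₂A) hv₂B) c₂ hc₂Y (fun h => dAC c₂ h hc₂C) (fun h => dBC c₂ h hc₂C)
    have e' := third A B v₁ hP₁ Y₂' hY₂'s v₂ a₂' hvY₂' (memB v₂ hv₂B) ha₂'Y (memA a₂' ha₂'A)
      (fun e => dAB v₂ (e ▸ ha₂'A) hv₂B) c₂' hc₂'Y (fun h => dAC c₂' h hc₂'C) (fun h => dBC c₂' h hc₂'C)
    exact collide Y₂ Y₂' hY₂s hY₂'s hY₂ne v₂ v₁ hvY₂ hvY₂' (e ▸ hc₂Y) (e' ▸ hc₂'Y) (fun h => hv₁B (h ▸ hv₂B))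
  -- (C2) `v₃ ∉ A`
  have hv₃A : v₃ ∉ A := by
    intro hv₃A
    have e := third A B v₁ hP₁ Y₃ hY₃s v₃ b₃ hvY₃ (memA v₃ hv₃A) hb₃Y (memB b₃ hb₃B)
      (fun e => dAB v₃ hv₃A (e ▸ hb₃B)) c₃ hc₃Y (fun h => dAC c₃ h hc₃C) (fun h => dBC c₃ h hc₃C)
    have e' := third A B v₁ hP₁ Y₃' hY₃'s v₃ b₃' hvY₃' (memA v₃ hv₃A) hb₃'Y (memB b₃' hb₃'B)
      (fun e => dAB v₃ hv₃A (e ▸ hb₃'B)) c₃' hc₃'Y (fun h => dAC c₃' h hc₃'C) (fun h => dBC c₃' h hc₃'C)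
    exact collide Y₃ Y₃' hY₃s hY₃'s hY₃ne v₃ v₁ hvY₃ hvY₃' (e ▸ hc₃Y) (e' ▸ hc₃'Y) (fun h => hv₁A (h ▸ hv₃A))
  -- (C3) `v₁ ∉ C`
  have hv₁C : v₁ ∉ C := by
    intro hv₁C
    have e := third A C v₂ hP₂ Y₁ hY₁s v₁ a₁ hvY₁ (memC' v₁ hv₁C) ha₁Y (memA' a₁ ha₁A)
      (fun e => dAC v₁ (e ▸ ha₁A) hv₁C) b₁ hb₁Y (fun h => dAB b₁ h hb₁B) (fun h => dBC b₁ hb₁B h)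
    have e' := third A C v₂ hP₂ Y₁' hY₁'s v₁ a₁' hvY₁' (memC' v₁ hv₁C) ha₁'Y (memA' a₁' ha₁'A)
      (fun e => dAC v₁ (e ▸ ha₁'A) hv₁C) b₁' hb₁'Y (fun h => dAB b₁' h hb₁'B) (fun h => dBC b₁' hb₁'B h)
    exact collide Y₁ Y₁' hY₁s hY₁'s hY₁ne v₁ v₂ hvY₁ hvY₁' (e ▸ hb₁Y) (e' ▸ hb₁'Y) (fun h => hv₂C (h ▸ hv₁C))
  -- (C4) `v₁ ≠ v₂`
  have h12 : v₁ ≠ v₂ := by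
    intro e
    have e' := third A B v₁ hP₁ Y₂ hY₂s v₂ a₂ hvY₂ (e ▸ memV₁) ha₂Y (memA a₂ ha₂A)
      (fun e'' => hv₂A (e'' ▸ ha₂A)) c₂ hc₂Y (fun h => dAC c₂ h hc₂C) (fun h => dBC c₂ h hc₂C)
    exact hv₂C (e ▸ e' ▸ hc₂C)
  -- (C5) `v₁ ≠ v₃`
  have h13 : v₁ ≠ v₃ := by
    intro e
    have e' := third A B v₁ hP₁ Y₃ hY₃s v₃ b₃ hvY₃ (e ▸ memV₁) hb₃Y (memB b₃ hb₃B)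
      (fun e'' => hv₃B (e'' ▸ hb₃B)) c₃ hc₃Y (fun h => dAC c₃ h hc₃C) (fun h => dBC c₃ h hc₃C)
    exact hv₃C (e ▸ e' ▸ hc₃C)
  -- (C6) `v₂ ≠ v₃`
  have h23 : v₂ ≠ v₃ := by
    intro e
    have e' := third A C v₂ hP₂ Y₃ hY₃s v₃ c₃ hvY₃ (e ▸ memV₂) hc₃Y (memC' c₃ hc₃C)
      (fun e'' => hv₃C (e'' ▸ hc₃C)) b₃ hb₃Y (fun h => dAB b₃ h hb₃B) (fun h => dBC b₃ hb₃B h)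
    exact hv₃B (e ▸ e' ▸ hb₃B)
  -- the hubs are off `P₀ = C ∪ (B ∪ (A ∪ ∅))` and off the other chords
  have hv₁P : v₁ ∉ unionL [C, B, A] := by
    simp only [unionL, Finset.union_empty, Finset.mem_union, not_or]
    exact ⟨hv₁C, hv₁B, hv₁A⟩
  have hv₂P : v₂ ∉ unionL [C, B, A] := by
    simp only [unionL, Finset.union_empty, Finset.mem_union, not_or]
    exact ⟨hv₂C, hv₂B, hv₂A⟩
  have hv₃P : v₃ ∉ unionL [C, B, A] := by
    simp only [unionL, Finset.union_empty, Finset.mem_union, not_or]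
    exact ⟨hv₃C, hv₃B, hv₃A⟩
  have notmem : ∀ (L₁ L₂ : Finset β) (v u : β) (Y : Finset β), Y ⊆ L₁ ∪ L₂ ∪ {v} → u ∉ L₁ → u ∉ L₂ → u ≠ v →
      u ∉ Y := by
    intro L₁ L₂ v u Y hY hu₁ hu₂ huv huY
    rcases Finset.mem_union.1 (hY huY) with h | h
    · rcases Finset.mem_union.1 h with h | h
      · exact hu₁ h
      · exact hu₂ h
    · exact huv (Finset.mem_singleton.1 h)
  have hv₁Y₂ : v₁ ∉ Y₂ := notmem A C v₂ v₁ Y₂ hY₂sub hv₁A hv₁C h12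
  have hv₁Y₃ : v₁ ∉ Y₃ := notmem B C v₃ v₁ Y₃ hY₃sub hv₁B hv₁C h13
  have hv₂Y₁ : v₂ ∉ Y₁ := notmem A B v₁ v₂ Y₁ hY₁sub hv₂A hv₂B (Ne.symm h12)
  have hv₂Y₃ : v₂ ∉ Y₃ := notmem B C v₃ v₂ Y₃ hY₃sub hv₂B hv₂C h23
  have hv₃Y₁ : v₃ ∉ Y₁ := notmem A B v₁ v₃ Y₁ hY₁sub hv₃A hv₃B (Ne.symm h13)
  have hv₃Y₂ : v₃ ∉ Y₂ := notmem A C v₂ v₃ Y₂ hY₂sub hv₃A hv₃C (Ne.symm h23)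
  have hY₁₂ : Y₁ ≠ Y₂ := fun e => hv₁Y₂ (e ▸ hvY₁)
  have hY₁₃ : Y₁ ≠ Y₃ := fun e => hv₁Y₃ (e ▸ hvY₁)
  have hY₂₃ : Y₂ ≠ Y₃ := fun e => hv₂Y₃ (e ▸ hvY₂)
  -- three free lines over the three big lines
  have hfree : freeCountR (unionL [C, B, A]) [Y₃, Y₂, Y₁] = 3 := by
    have := freeCountR_eq_length_of_off (unionL [C, B, A]) [Y₃, Y₂, Y₁] (by simp [Ne.symm hY₁₂,
      Ne.symm hY₁₃, Ne.symm hY₂₃]) (by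
      intro L hL
      simp only [List.mem_cons, List.not_mem_nil, or_false] at hL
      rcases hL with rfl | rfl | rfl
      · exact ⟨v₃, hvY₃, hv₃P, fun L' hL' hne => by
          simp only [List.mem_cons, List.not_mem_nil, or_false] at hL'
          rcases hL' with rfl | rfl | rfl
          · exact (hne rfl).elim
          · exact hv₃Y₂
          · exact hv₃Y₁⟩
      · exact ⟨v₂, hvY₂, hv₂P, fun L' hL' hne => by
          simp only [List.mem_cons, List.not_mem_nil, or_false] at hL'
          rcases hL' with rfl | rfl | rfl
          · exact hv₂Y₃
          · exact (hne rfl).elim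
          · exact hv₂Y₁⟩
      · exact ⟨v₁, hvY₁, hv₁P, fun L' hL' hne => by
          simp only [List.mem_cons, List.not_mem_nil, or_false] at hL'
          rcases hL' with rfl | rfl | rfl
          · exact hv₁Y₃
          · exact hv₁Y₂
          · exact (hne rfl).elim⟩)
    simpa using this
  have h2' := two_le_card_of_spec₇ h2
  have hb := budget_of_prefix h1 h2' h4 [C, B, A] [Y₃, Y₂, Y₁] (by
    simp [Ne.symm hY₁₂, Ne.symm hY₁₃, Ne.symm hY₂₃, hY₁A, hY₁B, hY₁C, hY₂A, hY₂B, hY₂C, hY₃A,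
      hY₃B, hY₃C, hBA, hCA, hCB])
    (by
      intro L hL
      simp only [List.mem_append, List.mem_cons, List.not_mem_nil, or_false] at hL
      rcases hL with (rfl | rfl | rfl) | (rfl | rfl | rfl)
      · exact hY₃s
      · exact hY₂s
      · exact hY₁s
      · exact hC
      · exact hB
      · exact hA)
    (by
      intro L hL
      simp only [List.mem_cons, List.not_mem_nil, or_false] at hL
      rcases hL with rfl | rfl | rfl
      · exact k₃
      · exact k₂
      · exact k₁)
  rw [hfree] at hb
  have hmono := fat_mono w (subset_unionLR (unionL [C, B, A]) [Y₃, Y₂, Y₁])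
  simp only [costSum, unionL, Finset.union_empty] at hb hmono
  rw [lineCost_empty, lineCost_of_inter_le_two (by omega),
    lineCost_of_inter_le_two (le_trans (card_inter_union_le C B A) (by omega))] at hb
  omega

end ThreeDisjoint

end Eight

end FourCap

end S1

end PercRepro
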